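import Summits.AtomisticToContinuum.Crystallization.Theses.PRVarianceCertificate
import Summits.AtomisticToContinuum.Crystallization.Theorems.PRVarianceCertificateCoerciveVarianceCertificateOptimalHcp
import Summits.AtomisticToContinuum.Crystallization.Theorems.PRVarianceCertificateCoerciveVarianceCertificateHcpEnergyBound
import Summits.AtomisticToContinuum.Crystallization.Theorems.PRVarianceCertificateCoerciveVarianceCertificatePricingSmall

/-!
# `CoerciveVarianceCertificate` (stmt-AtomisticToContinuum-11860): the route-level SPLIT, proved

Helper file of route `PRVarianceCertificate`, crux `CoerciveVarianceCertificate` (rank 3, = X of the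
thesis; flagged `summit_equivalent` by `crystallization_of_coerciveVarianceCertificate` in
`…CoerciveVarianceCertificateNecessity.lean`).  Nothing here closes the crux.  It lands, as a
tree theorem, the ASSEMBLY of the crux from its two open pieces — the BC2-redirect decomposition
filed by the crux strategist; the pieces are, verbatim, the two open registered stubs of line
`birth` (`Cruxes/CoerciveVarianceCertificate/Lines/birth.lean`), so the live lead's work lands on
the new leaves unchanged:

* `PricingLarge` — COARSE PRICING BY DEFICIT, template and constant pinned: for every optimal hcp
  pair `(a, h)` (minimising `e_LJ(hcp_{a',h'})` over `a', h' ≠ 0`), with `C := -24 · e_LJ(hcp_{a,h})`,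
  some `c₀ > 0` gives, for every Lennard-Jones ground state `x` of `N ≥ 19` particles,
  `c₀ · #{i : the 2a-window of x at x_i is not (a/100)-congruent, by a linear isometry, to a window
  of hcp_{a,h}} ≤ C · Σ_i t_i − Σ_i s_i²` (one resolution; the certificate half; energy side);
* `CoarseToFine` — COARSE-TO-FINE RIGIDITY WITH SCALE PINNING: for every optimal `(a, h)` and all
  `R, ε > 0` some `L > 0` makes, in every Lennard-Jones ground state, every particle all of whose
  `L`-neighbours are coarse-good an `(R, ε)`-good particle (no deficit at all; geometry/elasticity
  side).

`CoerciveVarianceCertificate_of_subs : PricingLarge → CoarseToFine → CoerciveVarianceCertificate`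
(the route decl BY NAME) is `split_of_five` fed with the three LANDED stubs of the line
(`stub_optimalHcp` p145271, `stub_hcpEnergyBound` p145251, `stub_pricingSmall` p146150): template
`P := hcp_{a,h}`, `C := -24 e`, `c₀' := min (1/50) c₀` (small clusters priced by participation),
`L(R, ε)` from rigidity, `δ` from `LennardJonesMinimalDistance_holds`, packing count
`K := (2L/δ + 1)³` (`card_le_of_separated_of_dist_le`), `c := c₀'/K` — every `(R, ε)`-bad particle
has a coarse-bad particle within `L`, so `#bad_{R,ε} ≤ K · #bad_coarse`.  The proofs are those of
the kernel-checked workfile `Lines/birth.lean` (planner-skel / leads c1–c3), renamed `split_*`.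

All statements are `[folklore]` bookkeeping (Blanc–Lewin 2015 §2; packing by volume).
-/

noncomputable section

namespace Summit.AtomisticToContinuum.Crystallization.Theorems.PRVarianceCertificate.CoerciveVarianceCertificate

open scoped BigOperators

/-- **The crux from three statements** (optimal hcp exists; free-constant coarse pricing for
`N ≥ 2`; coarse-to-fine rigidity), conclusion = the crux signature verbatim: `P := hcp_{a,h}`,
`C, c₀` from pricing, `L(R, ε)` from rigidity, `δ` the uniform minimal distance of LJ ground states,
`K := (2L/δ + 1)³` particles at most within `L` of any particle, `c := c₀ / K`. [folklore] -/
theorem split_of_three : (∃ (a h : ℝ) (ha : 0 < a) (hh : 0 < h), (∀ (a' h' : ℝ) (ha' : a' ≠ 0) (hh' : h' ≠ 0), (Literature.MathematicalPhysics.StatisticalMechanics.hcpPeriodicConfiguration ha.ne' hh.ne').energyPerParticle Literature.MathematicalPhysics.StatisticalMechanics.lennardJones ≤ (Literature.MathematicalPhysics.StatisticalMechanics.hcpPeriodicConfiguration ha' hh').energyPerParticle Literature.MathematicalPhysics.StatisticalMechanics.lennardJones)) → (∀ (a h : ℝ) (ha : 0 < a) (hh : 0 < h), (∀ (a' h' :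 ℝ) (ha' : a' ≠ 0) (hh' : h' ≠ 0), (Literature.MathematicalPhysics.StatisticalMechanics.hcpPeriodicConfiguration ha.ne' hh.ne').energyPerParticle Literature.MathematicalPhysics.StatisticalMechanics.lennardJones ≤ (Literature.MathematicalPhysics.StatisticalMechanics.hcpPeriodicConfiguration ha' hh').energyPerParticle Literature.MathematicalPhysics.StatisticalMechanics.lennardJones) → ∃ C : ℝ, 0 < C ∧ (Literature.MathematicalPhysics.StatisticalMechanics.hcpPeriodicConfiguration ha.ne' hh.ne').energyPerParticle Literature.MathematicalPhysics.StatisticalMechanics.lennardJones ≤ -(C / 24) ∧ ∃ c₀ : ℝ, 0 < c₀ ∧ ∀ (N : ℕ) (x : Fin N → EuclideanSpace ℝ (Fin 3)), Literature.MathematicalPhysics.StatisticalMechanics.IsGroundState Literature.MathematicalPhysics.StatisticalMechanics.lennardJones x → 2 ≤ N → c₀ * (Nat.card {i : Fin N // ¬ (∃ A : EuclideanSpace ℝ (Fin 3) →ₗᵢ[ℝ] EuclideanSpace ℝ (Fin 3), (∀ p ∈ (Literature.MathematicalPhysics.StatisticalMechanics.hcpPeriodicConfiguration ha.ne' hh.ne').points,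 ‖p‖ ≤ 2 * a → ∃ k : Fin N, dist (x k) (x i + A p) ≤ a / 100) ∧ (∀ k : Fin N, dist (x k) (x i) ≤ 2 * a → ∃ p ∈ (Literature.MathematicalPhysics.StatisticalMechanics.hcpPeriodicConfiguration ha.ne' hh.ne').points, dist (x k) (x i + A p) ≤ a / 100))} : ℝ) ≤ C * ∑ i, Literature.MathematicalPhysics.StatisticalMechanics.siteEnergy (fun r => (r⁻¹) ^ 12) x i - ∑ i, (Literature.MathematicalPhysics.StatisticalMechanics.siteEnergy (fun r => (r⁻¹) ^ 6) x i) ^ 2) → (∀ (a h : ℝ) (ha : 0 < a) (hh : 0 < h), (∀ (a' h' : ℝ) (ha' : a' ≠ 0) (hh' : h' ≠ 0), (Literature.MathematicalPhysics.StatisticalMechanics.hcpPeriodicConfiguration ha.ne' hh.ne').energyPerParticle Literature.MathematicalPhysics.StatisticalMechanics.lennardJones ≤ (Literature.MathematicalPhysics.StatisticalMechanics.hcpPeriodicConfiguration ha' hh').energyPerParticle Literature.MathematicalPhysics.StatisticalMechanics.lennardJones) → ∀ R ε : ℝ, 0 < R → 0 < ε → ∃ L : ℝ, 0 < L ∧ ∀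 (N : ℕ) (x : Fin N → EuclideanSpace ℝ (Fin 3)), Literature.MathematicalPhysics.StatisticalMechanics.IsGroundState Literature.MathematicalPhysics.StatisticalMechanics.lennardJones x → ∀ i : Fin N, (∀ j : Fin N, dist (x j) (x i) ≤ L → (∃ A : EuclideanSpace ℝ (Fin 3) →ₗᵢ[ℝ] EuclideanSpace ℝ (Fin 3), (∀ p ∈ (Literature.MathematicalPhysics.StatisticalMechanics.hcpPeriodicConfiguration ha.ne' hh.ne').points, ‖p‖ ≤ 2 * a → ∃ k : Fin N, dist (x k) (x j + A p) ≤ a / 100) ∧ (∀ k : Fin N, dist (x k) (x j) ≤ 2 * a → ∃ p ∈ (Literature.MathematicalPhysics.StatisticalMechanics.hcpPeriodicConfiguration ha.ne' hh.ne').points, dist (x k) (x j + A p) ≤ a / 100))) → (∃ A : EuclideanSpace ℝ (Fin 3) →ₗᵢ[ℝ] EuclideanSpace ℝ (Fin 3), (∀ p ∈ (Literature.MathematicalPhysics.StatisticalMechanics.hcpPeriodicConfiguration ha.ne' hh.ne').points, ‖p‖ ≤ R → ∃ k : Fin N, dist (x k) (x i + A p) ≤ ε) ∧ (∀ k : Fin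 N, dist (x k) (x i) ≤ R → ∃ p ∈ (Literature.MathematicalPhysics.StatisticalMechanics.hcpPeriodicConfiguration ha.ne' hh.ne').points, dist (x k) (x i + A p) ≤ ε))) → (∃ (P : Literature.MathematicalPhysics.StatisticalMechanics.PeriodicConfiguration 3) (C : ℝ), 0 < C ∧ P.energyPerParticle Literature.MathematicalPhysics.StatisticalMechanics.lennardJones ≤ -(C / 24) ∧ ∀ R ε : ℝ, 0 < R → 0 < ε → ∃ c : ℝ, 0 < c ∧ ∀ (N : ℕ) (x : Fin N → EuclideanSpace ℝ (Fin 3)), Literature.MathematicalPhysics.StatisticalMechanics.IsGroundState Literature.MathematicalPhysics.StatisticalMechanics.lennardJones x → 2 ≤ N → c * (Nat.card {i : Fin N // ¬ ∃ A : EuclideanSpace ℝ (Fin 3) →ₗᵢ[ℝ] EuclideanSpace ℝ (Fin 3), (∀ p ∈ P.points, ‖p‖ ≤ R → ∃ j : Fin N, dist (x j) (x i + A p) ≤ ε) ∧ (∀ j : Fin N, dist (x j) (x i) ≤ R → ∃ p ∈ P.points, dist (x j) (x i + A p) ≤ ε)} : ℝ) ≤ C * ∑ i, Literature.MathematicalPhysics.StatisticalMechanics.siteEnergy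 (fun r => (r⁻¹) ^ 12) x i - ∑ i, (Literature.MathematicalPhysics.StatisticalMechanics.siteEnergy (fun r => (r⁻¹) ^ 6) x i) ^ 2) := by
  intro h0 h1 h2
  obtain ⟨a, h, ha, hh, hopt⟩ := h0
  obtain ⟨C, hC, heP, c₀, hc₀, hprice⟩ := h1 a h ha hh hopt
  refine ⟨(Literature.MathematicalPhysics.StatisticalMechanics.hcpPeriodicConfiguration ha.ne' hh.ne'), C, hC, heP, ?_⟩
  intro R ε hR hε
  obtain ⟨L, hL, hrig⟩ := h2 a h ha hh hopt R ε hR hε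
  obtain ⟨δ, hδ, hsep⟩ := Literature.MathematicalPhysics.StatisticalMechanics.LennardJonesMinimalDistance_holds
  have hKpos : (0 : ℝ) < (2 * L / δ + 1) ^ 3 := by positivity
  refine ⟨c₀ / (2 * L / δ + 1) ^ 3, div_pos hc₀ hKpos, ?_⟩
  intro N x hx hN
  classical
  -- abbreviations for the two defect predicates (fine = the crux's, coarse = the stubs')
  set Bad : Fin N → Prop := fun i => ¬ (∃ A : EuclideanSpace ℝ (Fin 3) →ₗᵢ[ℝ] EuclideanSpace ℝ (Fin 3), (∀ p ∈ (Literature.MathematicalPhysics.StatisticalMechanics.hcpPeriodicConfiguration ha.ne' hh.ne').points, ‖p‖ ≤ R → ∃ k : Fin N, dist (x k) (x i + A p) ≤ ε) ∧ (∀ k : Fin N, dist (x k) (x i) ≤ R → ∃ p ∈ (Literature.MathematicalPhysics.StatisticalMechanics.hcpPeriodicConfiguration ha.ne' hh.ne').points, dist (x k) (x i + A p) ≤ ε)) with hBad_def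
  set Bad₀ : Fin N → Prop := fun i => ¬ (∃ A : EuclideanSpace ℝ (Fin 3) →ₗᵢ[ℝ] EuclideanSpace ℝ (Fin 3), (∀ p ∈ (Literature.MathematicalPhysics.StatisticalMechanics.hcpPeriodicConfiguration ha.ne' hh.ne').points, ‖p‖ ≤ 2 * a → ∃ k : Fin N, dist (x k) (x i + A p) ≤ a / 100) ∧ (∀ k : Fin N, dist (x k) (x i) ≤ 2 * a → ∃ p ∈ (Literature.MathematicalPhysics.StatisticalMechanics.hcpPeriodicConfiguration ha.ne' hh.ne').points, dist (x k) (x i + A p) ≤ a / 100)) with hBad₀_def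
  -- (1) every fine-bad particle has a coarse-bad particle within `L` (contrapositive of rigidity)
  have hnear : ∀ i, Bad i → ∃ j, dist (x j) (x i) ≤ L ∧ Bad₀ j := by
    intro i hi
    by_contra hcon
    exact hi (hrig N x hx i fun j hj => by_contra fun hj' => hcon ⟨j, hj, hj'⟩)
  -- (2) packing: at most `K` particles within `L` of any particle
  have hpack : ∀ j : Fin N,
      ((Finset.univ.filter fun i : Fin N => dist (x j) (x i) ≤ L).card : ℝ) ≤ (2 * L / δ + 1) ^ 3 := by
    intro j
    set S := Finset.univ.filter fun i : Fin N => dist (x j) (x i) ≤ L with hS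
    have hcard : (S.image x).card = S.card := Finset.card_image_of_injective S hx.1
    have h1 : ∀ c ∈ S.image x, dist c (x j) ≤ L := by
      intro c hc
      obtain ⟨i, hi, rfl⟩ := Finset.mem_image.1 hc
      rw [dist_comm]
      exact (Finset.mem_filter.1 hi).2
    have h2 : ∀ c ∈ S.image x, ∀ d ∈ S.image x, c ≠ d → δ ≤ dist c d := by
      intro c hc d hd hcd
      obtain ⟨i, -, rfl⟩ := Finset.mem_image.1 hc
      obtain ⟨i', -, rfl⟩ := Finset.mem_image.1 hd
      exact hsep N x hx i i' fun h => hcd (congrArg x h)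
    have h3 := Literature.MathematicalPhysics.StatisticalMechanics.card_le_of_separated_of_dist_le (S.image x) (x j) hδ hL.le h1 h2
    rw [finrank_euclideanSpace_fin, hcard] at h3
    exact h3
  -- (3) counting: `#Bad ≤ K · #Bad₀`
  have hcount : (Nat.card {i : Fin N // Bad i} : ℝ) ≤
      (2 * L / δ + 1) ^ 3 * (Nat.card {i : Fin N // Bad₀ i} : ℝ) := by
    have eB : Nat.card {i : Fin N // Bad i} = (Finset.univ.filter Bad).card := by
      rw [Nat.card_eq_fintype_card, Fintype.card_subtype]
    have eB₀ : Nat.card {i : Fin N // Bad₀ i} = (Finset.univ.filter Bad₀).card := by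
      rw [Nat.card_eq_fintype_card, Fintype.card_subtype]
    have hsub : Finset.univ.filter Bad ⊆
        (Finset.univ.filter Bad₀).biUnion fun j => Finset.univ.filter fun i : Fin N => dist (x j) (x i) ≤ L := by
      intro i hi
      obtain ⟨j, hj, hj₀⟩ := hnear i (Finset.mem_filter.1 hi).2
      exact Finset.mem_biUnion.2 ⟨j, Finset.mem_filter.2 ⟨Finset.mem_univ _, hj₀⟩,
        Finset.mem_filter.2 ⟨Finset.mem_univ _, hj⟩⟩
    have hle := (Finset.card_le_card hsub).trans Finset.card_biUnion_le
    rw [eB, eB₀]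
    calc ((Finset.univ.filter Bad).card : ℝ)
        ≤ ((∑ j ∈ Finset.univ.filter Bad₀,
            (Finset.univ.filter fun i : Fin N => dist (x j) (x i) ≤ L).card : ℕ) : ℝ) := by
          exact_mod_cast hle
      _ = ∑ j ∈ Finset.univ.filter Bad₀,
            ((Finset.univ.filter fun i : Fin N => dist (x j) (x i) ≤ L).card : ℝ) := by
          push_cast
          rfl
      _ ≤ ∑ _j ∈ Finset.univ.filter Bad₀, (2 * L / δ + 1) ^ 3 := Finset.sum_le_sum fun j _ => hpack j
      _ = (2 * L / δ + 1) ^ 3 * ((Finset.univ.filter Bad₀).card : ℝ) := by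
          rw [Finset.sum_const, nsmul_eq_mul, mul_comm]
  -- (4) the estimate
  have hfinal := hprice N x hx hN
  calc c₀ / (2 * L / δ + 1) ^ 3 * (Nat.card {i : Fin N // Bad i} : ℝ)
      ≤ c₀ / (2 * L / δ + 1) ^ 3 * ((2 * L / δ + 1) ^ 3 * (Nat.card {i : Fin N // Bad₀ i} : ℝ)) :=
        mul_le_mul_of_nonneg_left hcount (div_nonneg hc₀.le hKpos.le)
    _ = c₀ * (Nat.card {i : Fin N // Bad₀ i} : ℝ) := by
        field_simp
    _ ≤ _ := hfinal

/-- **Glue**: pinned pricing for all `N ≥ 2` from the energy bound, the small-cluster pricing and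
the large-`N` kernel (`c₀' := min (1/50) c₀`; `#bad ≤ N`). [folklore] -/
theorem split_pricing_of_small_large : (∀ (a h : ℝ) (ha : 0 < a) (hh : 0 < h), (∀ (a' h' : ℝ) (ha' : a' ≠ 0) (hh' : h' ≠ 0), (Literature.MathematicalPhysics.StatisticalMechanics.hcpPeriodicConfiguration ha.ne' hh.ne').energyPerParticle Literature.MathematicalPhysics.StatisticalMechanics.lennardJones ≤ (Literature.MathematicalPhysics.StatisticalMechanics.hcpPeriodicConfiguration ha' hh').energyPerParticle Literature.MathematicalPhysics.StatisticalMechanics.lennardJones) → (Literature.MathematicalPhysics.StatisticalMechanics.hcpPeriodicConfiguration ha.ne' hh.ne').energyPerParticle Literature.MathematicalPhysics.StatisticalMechanics.lennardJones ≤ -(7175 / 10000)) → (∀ (a h : ℝ) (ha : 0 < a) (hh : 0 < h), (Literature.MathematicalPhysics.StatisticalMechanics.hcpPeriodicConfiguration ha.ne' hh.ne').energyPerParticle Literature.MathematicalPhysics.StatisticalMechanics.lennardJones ≤ -(7175 / 10000) → ∀ (N : ℕ) (x : Fin N → EuclideanSpace ℝ (Fin 3)), Literature.MathematicalPhysics.StatisticalMechanics.IsGroundState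 Literature.MathematicalPhysics.StatisticalMechanics.lennardJones x → 2 ≤ N → N ≤ 18 → (1 / 50 : ℝ) * N ≤ (-(24 : ℝ) * (Literature.MathematicalPhysics.StatisticalMechanics.hcpPeriodicConfiguration ha.ne' hh.ne').energyPerParticle Literature.MathematicalPhysics.StatisticalMechanics.lennardJones) * ∑ i, Literature.MathematicalPhysics.StatisticalMechanics.siteEnergy (fun r => (r⁻¹) ^ 12) x i - ∑ i, (Literature.MathematicalPhysics.StatisticalMechanics.siteEnergy (fun r => (r⁻¹) ^ 6) x i) ^ 2) → (∀ (a h : ℝ) (ha : 0 < a) (hh : 0 < h), (∀ (a' h' : ℝ) (ha' : a' ≠ 0) (hh' : h' ≠ 0), (Literature.MathematicalPhysics.StatisticalMechanics.hcpPeriodicConfiguration ha.ne' hh.ne').energyPerParticle Literature.MathematicalPhysics.StatisticalMechanics.lennardJones ≤ (Literature.MathematicalPhysics.StatisticalMechanics.hcpPeriodicConfiguration ha' hh').energyPerParticle Literature.MathematicalPhysics.StatisticalMechanics.lennardJones) → ∃ c₀ : ℝ, 0 < c₀ ∧ ∀ (N : ℕ) (x : Fin N → EuclideanSpace ℝ (Fin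 3)), Literature.MathematicalPhysics.StatisticalMechanics.IsGroundState Literature.MathematicalPhysics.StatisticalMechanics.lennardJones x → 19 ≤ N → c₀ * (Nat.card {i : Fin N // ¬ (∃ A : EuclideanSpace ℝ (Fin 3) →ₗᵢ[ℝ] EuclideanSpace ℝ (Fin 3), (∀ p ∈ (Literature.MathematicalPhysics.StatisticalMechanics.hcpPeriodicConfiguration ha.ne' hh.ne').points, ‖p‖ ≤ 2 * a → ∃ k : Fin N, dist (x k) (x i + A p) ≤ a / 100) ∧ (∀ k : Fin N, dist (x k) (x i) ≤ 2 * a → ∃ p ∈ (Literature.MathematicalPhysics.StatisticalMechanics.hcpPeriodicConfiguration ha.ne' hh.ne').points, dist (x k) (x i + A p) ≤ a / 100))} : ℝ) ≤ (-(24 : ℝ) * (Literature.MathematicalPhysics.StatisticalMechanics.hcpPeriodicConfiguration ha.ne' hh.ne').energyPerParticle Literature.MathematicalPhysics.StatisticalMechanics.lennardJones) * ∑ i, Literature.MathematicalPhysics.StatisticalMechanics.siteEnergy (fun r => (r⁻¹) ^ 12) x i - ∑ i, (Literature.MathematicalPhysics.StatisticalMechanics.siteEnergy (fun r => (r⁻¹)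 ^ 6) x i) ^ 2) → (∀ (a h : ℝ) (ha : 0 < a) (hh : 0 < h), (∀ (a' h' : ℝ) (ha' : a' ≠ 0) (hh' : h' ≠ 0), (Literature.MathematicalPhysics.StatisticalMechanics.hcpPeriodicConfiguration ha.ne' hh.ne').energyPerParticle Literature.MathematicalPhysics.StatisticalMechanics.lennardJones ≤ (Literature.MathematicalPhysics.StatisticalMechanics.hcpPeriodicConfiguration ha' hh').energyPerParticle Literature.MathematicalPhysics.StatisticalMechanics.lennardJones) → ∃ c₀ : ℝ, 0 < c₀ ∧ ∀ (N : ℕ) (x : Fin N → EuclideanSpace ℝ (Fin 3)), Literature.MathematicalPhysics.StatisticalMechanics.IsGroundState Literature.MathematicalPhysics.StatisticalMechanics.lennardJones x → 2 ≤ N → c₀ * (Nat.card {i : Fin N // ¬ (∃ A : EuclideanSpace ℝ (Fin 3) →ₗᵢ[ℝ] EuclideanSpace ℝ (Fin 3), (∀ p ∈ (Literature.MathematicalPhysics.StatisticalMechanics.hcpPeriodicConfiguration ha.ne' hh.ne').points, ‖p‖ ≤ 2 * a → ∃ k : Fin N, dist (x k) (x i + A p) ≤ a / 100) ∧ (∀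 k : Fin N, dist (x k) (x i) ≤ 2 * a → ∃ p ∈ (Literature.MathematicalPhysics.StatisticalMechanics.hcpPeriodicConfiguration ha.ne' hh.ne').points, dist (x k) (x i + A p) ≤ a / 100))} : ℝ) ≤ (-(24 : ℝ) * (Literature.MathematicalPhysics.StatisticalMechanics.hcpPeriodicConfiguration ha.ne' hh.ne').energyPerParticle Literature.MathematicalPhysics.StatisticalMechanics.lennardJones) * ∑ i, Literature.MathematicalPhysics.StatisticalMechanics.siteEnergy (fun r => (r⁻¹) ^ 12) x i - ∑ i, (Literature.MathematicalPhysics.StatisticalMechanics.siteEnergy (fun r => (r⁻¹) ^ 6) x i) ^ 2) := by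
  intro hE hS hL a h ha hh hopt
  obtain ⟨c₀, hc₀, hlarge⟩ := hL a h ha hh hopt
  refine ⟨min (1 / 50) c₀, lt_min (by norm_num) hc₀, ?_⟩
  intro N x hx hN
  have hcard : (Nat.card {i : Fin N // ¬ (∃ A : EuclideanSpace ℝ (Fin 3) →ₗᵢ[ℝ] EuclideanSpace ℝ (Fin 3), (∀ p ∈ (Literature.MathematicalPhysics.StatisticalMechanics.hcpPeriodicConfiguration ha.ne' hh.ne').points, ‖p‖ ≤ 2 * a → ∃ k : Fin N, dist (x k) (x i + A p) ≤ a / 100) ∧ (∀ k : Fin N, dist (x k) (x i) ≤ 2 * a → ∃ p ∈ (Literature.MathematicalPhysics.StatisticalMechanics.hcpPeriodicConfiguration ha.ne' hh.ne').points, dist (x k) (x i + A p) ≤ a / 100))} : ℝ) ≤ N := by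
    classical
    rw [Nat.card_eq_fintype_card]
    exact_mod_cast (Fintype.card_subtype_le _).trans_eq (Fintype.card_fin N)
  have hcard0 : (0 : ℝ) ≤ (Nat.card {i : Fin N // ¬ (∃ A : EuclideanSpace ℝ (Fin 3) →ₗᵢ[ℝ] EuclideanSpace ℝ (Fin 3), (∀ p ∈ (Literature.MathematicalPhysics.StatisticalMechanics.hcpPeriodicConfiguration ha.ne' hh.ne').points, ‖p‖ ≤ 2 * a → ∃ k : Fin N, dist (x k) (x i + A p) ≤ a / 100) ∧ (∀ k : Fin N, dist (x k) (x i) ≤ 2 * a → ∃ p ∈ (Literature.MathematicalPhysics.StatisticalMechanics.hcpPeriodicConfiguration ha.ne' hh.ne').points, dist (x k) (x i + A p) ≤ a / 100))} : ℝ) := Nat.cast_nonneg _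
  by_cases hsmall : N ≤ 18
  · have h1 := hS a h ha hh (hE a h ha hh hopt) N x hx hN hsmall
    calc min (1 / 50) c₀ * (Nat.card {i : Fin N // ¬ (∃ A : EuclideanSpace ℝ (Fin 3) →ₗᵢ[ℝ] EuclideanSpace ℝ (Fin 3), (∀ p ∈ (Literature.MathematicalPhysics.StatisticalMechanics.hcpPeriodicConfiguration ha.ne' hh.ne').points, ‖p‖ ≤ 2 * a → ∃ k : Fin N, dist (x k) (x i + A p) ≤ a / 100) ∧ (∀ k : Fin N, dist (x k) (x i) ≤ 2 * a → ∃ p ∈ (Literature.MathematicalPhysics.StatisticalMechanics.hcpPeriodicConfiguration ha.ne' hh.ne').points, dist (x k) (x i + A p) ≤ a / 100))} : ℝ)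
        ≤ (1 / 50) * (N : ℝ) :=
          mul_le_mul (min_le_left _ _) hcard hcard0 (by norm_num)
      _ ≤ _ := h1
  · have h1 := hlarge N x hx (by omega)
    calc min (1 / 50) c₀ * (Nat.card {i : Fin N // ¬ (∃ A : EuclideanSpace ℝ (Fin 3) →ₗᵢ[ℝ] EuclideanSpace ℝ (Fin 3), (∀ p ∈ (Literature.MathematicalPhysics.StatisticalMechanics.hcpPeriodicConfiguration ha.ne' hh.ne').points, ‖p‖ ≤ 2 * a → ∃ k : Fin N, dist (x k) (x i + A p) ≤ a / 100) ∧ (∀ k : Fin N, dist (x k) (x i) ≤ 2 * a → ∃ p ∈ (Literature.MathematicalPhysics.StatisticalMechanics.hcpPeriodicConfiguration ha.ne' hh.ne').points, dist (x k) (x i + A p) ≤ a / 100))} : ℝ)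
        ≤ c₀ * (Nat.card {i : Fin N // ¬ (∃ A : EuclideanSpace ℝ (Fin 3) →ₗᵢ[ℝ] EuclideanSpace ℝ (Fin 3), (∀ p ∈ (Literature.MathematicalPhysics.StatisticalMechanics.hcpPeriodicConfiguration ha.ne' hh.ne').points, ‖p‖ ≤ 2 * a → ∃ k : Fin N, dist (x k) (x i + A p) ≤ a / 100) ∧ (∀ k : Fin N, dist (x k) (x i) ≤ 2 * a → ∃ p ∈ (Literature.MathematicalPhysics.StatisticalMechanics.hcpPeriodicConfiguration ha.ne' hh.ne').points, dist (x k) (x i + A p) ≤ a / 100))} : ℝ) :=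
          mul_le_mul_of_nonneg_right (min_le_right _ _) hcard0
      _ ≤ _ := h1

/-- **Glue**: the pinned pair (energy bound, pinned pricing) gives the free-constant coarse pricing
statement (`C := -24·e`, `0 < C` from `e ≤ -0.7175`, `e = -C/24`). [folklore] -/
theorem split_coarsePricing_of_pinned : (∀ (a h : ℝ) (ha : 0 < a) (hh : 0 < h), (∀ (a' h' : ℝ) (ha' : a' ≠ 0) (hh' : h' ≠ 0), (Literature.MathematicalPhysics.StatisticalMechanics.hcpPeriodicConfiguration ha.ne' hh.ne').energyPerParticle Literature.MathematicalPhysics.StatisticalMechanics.lennardJones ≤ (Literature.MathematicalPhysics.StatisticalMechanics.hcpPeriodicConfiguration ha' hh').energyPerParticle Literature.MathematicalPhysics.StatisticalMechanics.lennardJones) → (Literature.MathematicalPhysics.StatisticalMechanics.hcpPeriodicConfiguration ha.ne' hh.ne').energyPerParticle Literature.MathematicalPhysics.StatisticalMechanics.lennardJones ≤ -(7175 / 10000)) → (∀ (a h : ℝ) (ha : 0 < a) (hh : 0 < h), (∀ (a' h' : ℝ) (ha' : a' ≠ 0) (hh' : h' ≠ 0), (Literature.MathematicalPhysics.StatisticalMechanics.hcpPeriodicConfiguration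 ha.ne' hh.ne').energyPerParticle Literature.MathematicalPhysics.StatisticalMechanics.lennardJones ≤ (Literature.MathematicalPhysics.StatisticalMechanics.hcpPeriodicConfiguration ha' hh').energyPerParticle Literature.MathematicalPhysics.StatisticalMechanics.lennardJones) → ∃ c₀ : ℝ, 0 < c₀ ∧ ∀ (N : ℕ) (x : Fin N → EuclideanSpace ℝ (Fin 3)), Literature.MathematicalPhysics.StatisticalMechanics.IsGroundState Literature.MathematicalPhysics.StatisticalMechanics.lennardJones x → 2 ≤ N → c₀ * (Nat.card {i : Fin N // ¬ (∃ A : EuclideanSpace ℝ (Fin 3) →ₗᵢ[ℝ] EuclideanSpace ℝ (Fin 3), (∀ p ∈ (Literature.MathematicalPhysics.StatisticalMechanics.hcpPeriodicConfiguration ha.ne' hh.ne').points, ‖p‖ ≤ 2 * a → ∃ k : Fin N, dist (x k) (x i + A p) ≤ a / 100) ∧ (∀ k : Fin N, dist (x k) (x i) ≤ 2 * a → ∃ p ∈ (Literature.MathematicalPhysics.StatisticalMechanics.hcpPeriodicConfiguration ha.ne' hh.ne').points, dist (x k) (x i + A p) ≤ a / 100))} : ℝ) ≤ (-(24 : ℝ)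 * (Literature.MathematicalPhysics.StatisticalMechanics.hcpPeriodicConfiguration ha.ne' hh.ne').energyPerParticle Literature.MathematicalPhysics.StatisticalMechanics.lennardJones) * ∑ i, Literature.MathematicalPhysics.StatisticalMechanics.siteEnergy (fun r => (r⁻¹) ^ 12) x i - ∑ i, (Literature.MathematicalPhysics.StatisticalMechanics.siteEnergy (fun r => (r⁻¹) ^ 6) x i) ^ 2) → (∀ (a h : ℝ) (ha : 0 < a) (hh : 0 < h), (∀ (a' h' : ℝ) (ha' : a' ≠ 0) (hh' : h' ≠ 0), (Literature.MathematicalPhysics.StatisticalMechanics.hcpPeriodicConfiguration ha.ne' hh.ne').energyPerParticle Literature.MathematicalPhysics.StatisticalMechanics.lennardJones ≤ (Literature.MathematicalPhysics.StatisticalMechanics.hcpPeriodicConfiguration ha' hh').energyPerParticle Literature.MathematicalPhysics.StatisticalMechanics.lennardJones) → ∃ C : ℝ, 0 < C ∧ (Literature.MathematicalPhysics.StatisticalMechanics.hcpPeriodicConfiguration ha.ne' hh.ne').energyPerParticle Literature.MathematicalPhysics.StatisticalMechanics.lennardJones ≤ -(C / 24) ∧ ∃ c₀ : ℝ, 0 <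 c₀ ∧ ∀ (N : ℕ) (x : Fin N → EuclideanSpace ℝ (Fin 3)), Literature.MathematicalPhysics.StatisticalMechanics.IsGroundState Literature.MathematicalPhysics.StatisticalMechanics.lennardJones x → 2 ≤ N → c₀ * (Nat.card {i : Fin N // ¬ (∃ A : EuclideanSpace ℝ (Fin 3) →ₗᵢ[ℝ] EuclideanSpace ℝ (Fin 3), (∀ p ∈ (Literature.MathematicalPhysics.StatisticalMechanics.hcpPeriodicConfiguration ha.ne' hh.ne').points, ‖p‖ ≤ 2 * a → ∃ k : Fin N, dist (x k) (x i + A p) ≤ a / 100) ∧ (∀ k : Fin N, dist (x k) (x i) ≤ 2 * a → ∃ p ∈ (Literature.MathematicalPhysics.StatisticalMechanics.hcpPeriodicConfiguration ha.ne' hh.ne').points, dist (x k) (x i + A p) ≤ a / 100))} : ℝ) ≤ C * ∑ i, Literature.MathematicalPhysics.StatisticalMechanics.siteEnergy (fun r => (r⁻¹) ^ 12) x i - ∑ i, (Literature.MathematicalPhysics.StatisticalMechanics.siteEnergy (fun r => (r⁻¹) ^ 6) x i) ^ 2) := by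
  intro hE hP a h ha hh hopt
  obtain ⟨c₀, hc₀, hprice⟩ := hP a h ha hh hopt
  have he := hE a h ha hh hopt
  refine ⟨-(24 : ℝ) * (Literature.MathematicalPhysics.StatisticalMechanics.hcpPeriodicConfiguration ha.ne' hh.ne').energyPerParticle Literature.MathematicalPhysics.StatisticalMechanics.lennardJones, by linarith, by linarith, c₀, hc₀, ?_⟩
  intro N x hx hN
  exact hprice N x hx hN

/-- **The crux from the five stub statements of line `birth`** (`stub_optimalHcp`,
`stub_hcpEnergyBound`, `stub_pricingSmall`, `stub_pricingLarge` = `PricingLarge`,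
`stub_coarseToFine` = `CoarseToFine`), conclusion = the crux signature verbatim. [folklore] -/
theorem split_of_five : (∃ (a h : ℝ) (ha : 0 < a) (hh : 0 < h), (∀ (a' h' : ℝ) (ha' : a' ≠ 0) (hh' : h' ≠ 0), (Literature.MathematicalPhysics.StatisticalMechanics.hcpPeriodicConfiguration ha.ne' hh.ne').energyPerParticle Literature.MathematicalPhysics.StatisticalMechanics.lennardJones ≤ (Literature.MathematicalPhysics.StatisticalMechanics.hcpPeriodicConfiguration ha' hh').energyPerParticle Literature.MathematicalPhysics.StatisticalMechanics.lennardJones)) → (∀ (a h : ℝ) (ha : 0 < a) (hh : 0 < h), (∀ (a' h' : ℝ) (ha' : a' ≠ 0) (hh' : h' ≠ 0), (Literature.MathematicalPhysics.StatisticalMechanics.hcpPeriodicConfiguration ha.ne' hh.ne').energyPerParticle Literature.MathematicalPhysics.StatisticalMechanics.lennardJones ≤ (Literature.MathematicalPhysics.StatisticalMechanics.hcpPeriodicConfiguration ha' hh').energyPerParticle Literature.MathematicalPhysics.StatisticalMechanics.lennardJones) → (Literature.MathematicalPhysics.StatisticalMechanics.hcpPeriodicConfiguration ha.ne' hh.ne').energyPerParticle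 Literature.MathematicalPhysics.StatisticalMechanics.lennardJones ≤ -(7175 / 10000)) → (∀ (a h : ℝ) (ha : 0 < a) (hh : 0 < h), (Literature.MathematicalPhysics.StatisticalMechanics.hcpPeriodicConfiguration ha.ne' hh.ne').energyPerParticle Literature.MathematicalPhysics.StatisticalMechanics.lennardJones ≤ -(7175 / 10000) → ∀ (N : ℕ) (x : Fin N → EuclideanSpace ℝ (Fin 3)), Literature.MathematicalPhysics.StatisticalMechanics.IsGroundState Literature.MathematicalPhysics.StatisticalMechanics.lennardJones x → 2 ≤ N → N ≤ 18 → (1 / 50 : ℝ) * N ≤ (-(24 : ℝ) * (Literature.MathematicalPhysics.StatisticalMechanics.hcpPeriodicConfiguration ha.ne' hh.ne').energyPerParticle Literature.MathematicalPhysics.StatisticalMechanics.lennardJones) * ∑ i, Literature.MathematicalPhysics.StatisticalMechanics.siteEnergy (fun r => (r⁻¹) ^ 12) x i - ∑ i, (Literature.MathematicalPhysics.StatisticalMechanics.siteEnergy (fun r => (r⁻¹) ^ 6) x i) ^ 2) → (∀ (a h : ℝ) (ha : 0 < a) (hh : 0 < h), (∀ (a' h' : ℝ) (ha' : a' ≠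 0) (hh' : h' ≠ 0), (Literature.MathematicalPhysics.StatisticalMechanics.hcpPeriodicConfiguration ha.ne' hh.ne').energyPerParticle Literature.MathematicalPhysics.StatisticalMechanics.lennardJones ≤ (Literature.MathematicalPhysics.StatisticalMechanics.hcpPeriodicConfiguration ha' hh').energyPerParticle Literature.MathematicalPhysics.StatisticalMechanics.lennardJones) → ∃ c₀ : ℝ, 0 < c₀ ∧ ∀ (N : ℕ) (x : Fin N → EuclideanSpace ℝ (Fin 3)), Literature.MathematicalPhysics.StatisticalMechanics.IsGroundState Literature.MathematicalPhysics.StatisticalMechanics.lennardJones x → 19 ≤ N → c₀ * (Nat.card {i : Fin N // ¬ (∃ A : EuclideanSpace ℝ (Fin 3) →ₗᵢ[ℝ] EuclideanSpace ℝ (Fin 3), (∀ p ∈ (Literature.MathematicalPhysics.StatisticalMechanics.hcpPeriodicConfiguration ha.ne' hh.ne').points, ‖p‖ ≤ 2 * a → ∃ k : Fin N, dist (x k) (x i + A p) ≤ a / 100) ∧ (∀ k : Fin N, dist (x k) (x i) ≤ 2 * a → ∃ p ∈ (Literature.MathematicalPhysics.StatisticalMechanics.hcpPeriodicConfiguration ha.ne'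 hh.ne').points, dist (x k) (x i + A p) ≤ a / 100))} : ℝ) ≤ (-(24 : ℝ) * (Literature.MathematicalPhysics.StatisticalMechanics.hcpPeriodicConfiguration ha.ne' hh.ne').energyPerParticle Literature.MathematicalPhysics.StatisticalMechanics.lennardJones) * ∑ i, Literature.MathematicalPhysics.StatisticalMechanics.siteEnergy (fun r => (r⁻¹) ^ 12) x i - ∑ i, (Literature.MathematicalPhysics.StatisticalMechanics.siteEnergy (fun r => (r⁻¹) ^ 6) x i) ^ 2) → (∀ (a h : ℝ) (ha : 0 < a) (hh : 0 < h), (∀ (a' h' : ℝ) (ha' : a' ≠ 0) (hh' : h' ≠ 0), (Literature.MathematicalPhysics.StatisticalMechanics.hcpPeriodicConfiguration ha.ne' hh.ne').energyPerParticle Literature.MathematicalPhysics.StatisticalMechanics.lennardJones ≤ (Literature.MathematicalPhysics.StatisticalMechanics.hcpPeriodicConfiguration ha' hh').energyPerParticle Literature.MathematicalPhysics.StatisticalMechanics.lennardJones) → ∀ R ε : ℝ, 0 < R → 0 < ε → ∃ L : ℝ, 0 < L ∧ ∀ (N : ℕ) (x : Fin N → EuclideanSpace ℝ (Fin 3)),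 Literature.MathematicalPhysics.StatisticalMechanics.IsGroundState Literature.MathematicalPhysics.StatisticalMechanics.lennardJones x → ∀ i : Fin N, (∀ j : Fin N, dist (x j) (x i) ≤ L → (∃ A : EuclideanSpace ℝ (Fin 3) →ₗᵢ[ℝ] EuclideanSpace ℝ (Fin 3), (∀ p ∈ (Literature.MathematicalPhysics.StatisticalMechanics.hcpPeriodicConfiguration ha.ne' hh.ne').points, ‖p‖ ≤ 2 * a → ∃ k : Fin N, dist (x k) (x j + A p) ≤ a / 100) ∧ (∀ k : Fin N, dist (x k) (x j) ≤ 2 * a → ∃ p ∈ (Literature.MathematicalPhysics.StatisticalMechanics.hcpPeriodicConfiguration ha.ne' hh.ne').points, dist (x k) (x j + A p) ≤ a / 100))) → (∃ A : EuclideanSpace ℝ (Fin 3) →ₗᵢ[ℝ] EuclideanSpace ℝ (Fin 3), (∀ p ∈ (Literature.MathematicalPhysics.StatisticalMechanics.hcpPeriodicConfiguration ha.ne' hh.ne').points, ‖p‖ ≤ R → ∃ k : Fin N, dist (x k) (x i + A p) ≤ ε) ∧ (∀ k : Fin N, dist (x k) (x i) ≤ R → ∃ p ∈ (Literature.MathematicalPhysics.StatisticalMechanics.hcpPeriodicConfiguration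 ha.ne' hh.ne').points, dist (x k) (x i + A p) ≤ ε))) → (∃ (P : Literature.MathematicalPhysics.StatisticalMechanics.PeriodicConfiguration 3) (C : ℝ), 0 < C ∧ P.energyPerParticle Literature.MathematicalPhysics.StatisticalMechanics.lennardJones ≤ -(C / 24) ∧ ∀ R ε : ℝ, 0 < R → 0 < ε → ∃ c : ℝ, 0 < c ∧ ∀ (N : ℕ) (x : Fin N → EuclideanSpace ℝ (Fin 3)), Literature.MathematicalPhysics.StatisticalMechanics.IsGroundState Literature.MathematicalPhysics.StatisticalMechanics.lennardJones x → 2 ≤ N → c * (Nat.card {i : Fin N // ¬ ∃ A : EuclideanSpace ℝ (Fin 3) →ₗᵢ[ℝ] EuclideanSpace ℝ (Fin 3), (∀ p ∈ P.points, ‖p‖ ≤ R → ∃ j : Fin N, dist (x j) (x i + A p) ≤ ε) ∧ (∀ j : Fin N, dist (x j) (x i) ≤ R → ∃ p ∈ P.points, dist (x j) (x i + A p) ≤ ε)} : ℝ) ≤ C * ∑ i, Literature.MathematicalPhysics.StatisticalMechanics.siteEnergy (fun r => (r⁻¹) ^ 12) x i - ∑ i, (Literature.MathematicalPhysics.StatisticalMechanics.siteEnergy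 (fun r => (r⁻¹) ^ 6) x i) ^ 2) :=
  fun h0 hE hS hL h2 =>
    split_of_three h0 (split_coarsePricing_of_pinned hE (split_pricing_of_small_large hE hS hL)) h2

/-- **ASSEMBLY OF THE ROUTE-LEVEL SPLIT (BC2 redirect).**
`PricingLarge → CoarseToFine → CoerciveVarianceCertificate` — the route decl BY NAME, the two
hypotheses being verbatim the statements of the pieces `PricingLarge`, `CoarseToFine` (= the open
registered stubs `stub_pricingLarge`, `stub_coarseToFine` of line `birth`); the three closed stubs
enter by name from the tree (`stub_optimalHcp`, `stub_hcpEnergyBound`, `stub_pricingSmall`).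
[folklore] -/
theorem CoerciveVarianceCertificate_of_subs : (∀ (a h : ℝ) (ha : 0 < a) (hh : 0 < h), (∀ (a' h' : ℝ) (ha' : a' ≠ 0) (hh' : h' ≠ 0), (Literature.MathematicalPhysics.StatisticalMechanics.hcpPeriodicConfiguration ha.ne' hh.ne').energyPerParticle Literature.MathematicalPhysics.StatisticalMechanics.lennardJones ≤ (Literature.MathematicalPhysics.StatisticalMechanics.hcpPeriodicConfiguration ha' hh').energyPerParticle Literature.MathematicalPhysics.StatisticalMechanics.lennardJones) → ∃ c₀ : ℝ, 0 < c₀ ∧ ∀ (N : ℕ) (x : Fin N → EuclideanSpace ℝ (Fin 3)), Literature.MathematicalPhysics.StatisticalMechanics.IsGroundState Literature.MathematicalPhysics.StatisticalMechanics.lennardJones x → 19 ≤ N → c₀ * (Nat.card {i : Fin N // ¬ (∃ A : EuclideanSpace ℝ (Fin 3) →ₗᵢ[ℝ] EuclideanSpace ℝ (Fin 3), (∀ p ∈ (Literature.MathematicalPhysics.StatisticalMechanics.hcpPeriodicConfiguration ha.ne' hh.ne').points, ‖p‖ ≤ 2 * a → ∃ k : Fin N, dist (x k) (x i + A p) ≤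 a / 100) ∧ (∀ k : Fin N, dist (x k) (x i) ≤ 2 * a → ∃ p ∈ (Literature.MathematicalPhysics.StatisticalMechanics.hcpPeriodicConfiguration ha.ne' hh.ne').points, dist (x k) (x i + A p) ≤ a / 100))} : ℝ) ≤ (-(24 : ℝ) * (Literature.MathematicalPhysics.StatisticalMechanics.hcpPeriodicConfiguration ha.ne' hh.ne').energyPerParticle Literature.MathematicalPhysics.StatisticalMechanics.lennardJones) * ∑ i, Literature.MathematicalPhysics.StatisticalMechanics.siteEnergy (fun r => (r⁻¹) ^ 12) x i - ∑ i, (Literature.MathematicalPhysics.StatisticalMechanics.siteEnergy (fun r => (r⁻¹) ^ 6) x i) ^ 2) → (∀ (a h : ℝ) (ha : 0 < a) (hh : 0 < h), (∀ (a' h' : ℝ) (ha' : a' ≠ 0) (hh' : h' ≠ 0), (Literature.MathematicalPhysics.StatisticalMechanics.hcpPeriodicConfiguration ha.ne' hh.ne').energyPerParticle Literature.MathematicalPhysics.StatisticalMechanics.lennardJones ≤ (Literature.MathematicalPhysics.StatisticalMechanics.hcpPeriodicConfiguration ha' hh').energyPerParticle Literature.MathematicalPhysics.StatisticalMechanics.lennardJones)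 → ∀ R ε : ℝ, 0 < R → 0 < ε → ∃ L : ℝ, 0 < L ∧ ∀ (N : ℕ) (x : Fin N → EuclideanSpace ℝ (Fin 3)), Literature.MathematicalPhysics.StatisticalMechanics.IsGroundState Literature.MathematicalPhysics.StatisticalMechanics.lennardJones x → ∀ i : Fin N, (∀ j : Fin N, dist (x j) (x i) ≤ L → (∃ A : EuclideanSpace ℝ (Fin 3) →ₗᵢ[ℝ] EuclideanSpace ℝ (Fin 3), (∀ p ∈ (Literature.MathematicalPhysics.StatisticalMechanics.hcpPeriodicConfiguration ha.ne' hh.ne').points, ‖p‖ ≤ 2 * a → ∃ k : Fin N, dist (x k) (x j + A p) ≤ a / 100) ∧ (∀ k : Fin N, dist (x k) (x j) ≤ 2 * a → ∃ p ∈ (Literature.MathematicalPhysics.StatisticalMechanics.hcpPeriodicConfiguration ha.ne' hh.ne').points, dist (x k) (x j + A p) ≤ a / 100))) → (∃ A : EuclideanSpace ℝ (Fin 3) →ₗᵢ[ℝ] EuclideanSpace ℝ (Fin 3), (∀ p ∈ (Literature.MathematicalPhysics.StatisticalMechanics.hcpPeriodicConfiguration ha.ne' hh.ne').points, ‖p‖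 ≤ R → ∃ k : Fin N, dist (x k) (x i + A p) ≤ ε) ∧ (∀ k : Fin N, dist (x k) (x i) ≤ R → ∃ p ∈ (Literature.MathematicalPhysics.StatisticalMechanics.hcpPeriodicConfiguration ha.ne' hh.ne').points, dist (x k) (x i + A p) ≤ ε))) → Summit.AtomisticToContinuum.Crystallization.Theses.PRVarianceCertificate.CoerciveVarianceCertificate :=
  fun hL h2 => split_of_five stub_optimalHcp stub_hcpEnergyBound stub_pricingSmall hL h2

end Summit.AtomisticToContinuum.Crystallization.Theorems.PRVarianceCertificate.CoerciveVarianceCertificate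

end
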